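import Literature.Analysis.FluidPDE.DriftHeatKernelBarrier
import Literature.Analysis.FluidPDE.DriftHeatGaussianBounds
import Literature.Analysis.FluidPDE.DriftHeatLocalComparison
import Literature.Analysis.UnboundedOperators.HeatKernelHeatEquation
import HarnessLib

/-!
# Gaussian lower bound of a nonnegative solution of `uₜ + a·∇u − Δu = 0` by its earlier local mass

Analysis/FluidPDE proofs file (theorems only) on the discharge path of the named fact
`Literature.Analysis.FluidPDE.Lieberman1996_weak_harnack` (Lieberman 1996, Ch. VI, Corollary 6.24,
the weak Harnack inequality with flexible cylinders, for the linear equation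
`uₜ + a·∇u − Δu = 0` with bounded measurable drift). Because the principal part is the Laplacian
and the solutions of the vendored class are classical in space, the `L¹`-weak Harnack inequality
can be proved by *Gaussian comparison* instead of Moser iteration; this file provides the
comparison step. For a member `u` of the local class `IsDriftHeatSolutionOn a u A S U`
(`DriftHeatLocalClass`) that is nonnegative on `[t_b, t_T] × B̄(c, ρ)` and a continuous weight
`0 ≤ h ≤ u(t_b, ·)` supported in `B̄(c, r_s)`, `r_s < ρ`:

* `exists_heatExtension_le_add` — the one-sided approximate-identity estimate
  `e^{σΔ}h ≤ h + δ` on a compact set, uniformly for small `σ > 0` (from the joint limit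
  `tendsto_heatExtension_nhdsWithin_prod` of `HeatKernelHeatEquation` and compactness);
* `driftKernelBarrier_neg_le_heatExtension` — the subsolution barrier
  `Ψ(σ) = k₋(σ) ⋆ h` (`DriftHeatKernelBarrier`) lies below the caloric extension `e^{σΔ} h`;
* `IsDriftHeatSolutionOn.kernel_comparison` — comparison of `u` on `[t_b, t_T] × B̄(c, ρ)` with
  the classical barrier `Ψ(t − t_b + σ₀) − (∫h)·gaussTail(ρ − r_s, t − t_b + σ₀) − δ`
  (`paraboloid_comparison` of `DriftHeatLocalComparison` on a straight cylinder; on the side the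
  barrier is `≤ −δ` by the off-ball Gaussian bound, the correction is nondecreasing while
  `2n·age ≤ (ρ − r_s)²` by `gaussTailDt_nonneg`);
* `IsDriftHeatSolutionOn.kernel_lower_bound` — letting `σ₀, δ → 0`:
  `u(t, x) ≥ (∫ h) · (kSubLow n A (r_e + r_s) (t − t_b) − gaussTail n (ρ − r_s) (t − t_b))`
  for `x ∈ B̄(c, r_e)`, `t_b < t ≤ t_T`, i.e. a pointwise lower bound at later times by the mass
  of `u(t_b, ·)` near `c` times an explicit Gaussian profile (positive at small age, see
  `DriftHeatGaussianBounds.eventually_small_age`).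

## References

* G. M. Lieberman, *Second Order Parabolic Differential Equations*, World Scientific (1996),
  Ch. II (comparison), Ch. VI §6 Theorem 6.18, Corollary 6.24. [Lieberman1996]
* L. C. Evans, *Partial Differential Equations*, 2nd ed. (2010), §2.3.1 Theorem 1 (iii).
  [Evans2010]
-/

noncomputable section

open MeasureTheory Set Function Filter Metric Real InnerProductSpace Topology
open scoped Laplacian

namespace Literature.Analysis.FluidPDE

variable {E : Type*} [NormedAddCommGroup E] [InnerProductSpace ℝ E] [FiniteDimensional ℝ E]
  [MeasurableSpace E] [BorelSpace E]

/-! ### A uniform one-sided approximate identity for the caloric extension -/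

/-- **Uniform one-sided approximate identity**: for a continuous compactly supported `h`, a
compact `K` and `δ > 0`, `e^{σΔ} h (x) ≤ h(x) + δ` for all `x ∈ K` and all sufficiently small
`σ > 0` (joint continuity of the caloric extension at the initial time, Evans §2.3.1 Thm 1(iii),
plus compactness of `K`). [cite: Evans2010, §2.3.1 Theorem 1(iii)] -/
theorem exists_heatExtension_le_add {h : E → ℝ} (hh : Continuous h) (hhs : HasCompactSupport h)
    {K : Set E} (hK : IsCompact K) {δ : ℝ} (hδ : 0 < δ) :
    ∃ σ₁ : ℝ, 0 < σ₁ ∧ ∀ σ ∈ Ioo 0 σ₁, ∀ x ∈ K,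
      UnboundedOperators.heatExtension h σ x ≤ h x + δ := by
  obtain ⟨C, hC⟩ := hh.bounded_above_of_compact_support hhs
  have hP : ∀ x₀ ∈ K, ∀ᶠ q : ℝ × E in 𝓝 ((0 : ℝ), x₀),
      0 < q.1 → UnboundedOperators.heatExtension h q.1 q.2 ≤ h q.2 + δ := by
    intro x₀ _
    have hT := UnboundedOperators.tendsto_heatExtension_nhdsWithin_prod (F := ℝ) hh hC x₀
    have h1 : ∀ᶠ q : ℝ × E in 𝓝[Ioi 0 ×ˢ univ] ((0 : ℝ), x₀),
        UnboundedOperators.heatExtension h q.1 q.2 < h x₀ + δ / 2 :=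
      hT (Iio_mem_nhds (by linarith))
    have h2 : ∀ᶠ q : ℝ × E in 𝓝 ((0 : ℝ), x₀), h x₀ - δ / 2 < h q.2 := by
      have hc : ContinuousAt (fun q : ℝ × E => h q.2) ((0 : ℝ), x₀) :=
        (hh.comp continuous_snd).continuousAt
      exact hc.tendsto.eventually (lt_mem_nhds (by linarith))
    rw [eventually_nhdsWithin_iff] at h1
    filter_upwards [h1, h2] with q hq1 hq2 hq
    have := hq1 ⟨hq, mem_univ _⟩
    linarith
  have hev := hK.eventually_forall_of_forall_eventually
    (P := fun σ x => 0 < σ → UnboundedOperators.heatExtension h σ x ≤ h x + δ) hP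
  obtain ⟨ε, hε, hball⟩ := Metric.eventually_nhds_iff.1 hev
  refine ⟨ε, hε, fun σ hσ x hx => hball ?_ x hx hσ.1⟩
  rw [Real.dist_eq, sub_zero, abs_of_pos hσ.1]
  exact hσ.2

/-! ### The subsolution barrier lies below the caloric extension -/

omit [FiniteDimensional ℝ E] [MeasurableSpace E] [BorelSpace E] in
/-- The subsolution kernel is dominated by the heat kernel: `k₋(σ, y) ≤ heatKernel σ y`
(`A ≥ 0`, `σ > 0`; the tilt factor `e^{−(…)}` is at most one). [folklore] -/
theorem driftKernel_neg_one_le_heatKernel {A σ : ℝ} (hA : 0 ≤ A) (hσ : 0 < σ) (y : E) :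
    driftKernel (-1) A σ y ≤ UnboundedOperators.heatKernel σ y := by
  rw [driftKernel_eq_heatKernel_mul]
  refine mul_le_of_le_one_right (UnboundedOperators.heatKernel_pos hσ y).le ?_
  rw [exp_le_one_iff]
  have hg := driftKernel_tilt_nonneg (E := E) hA hσ.le y
  nlinarith

/-- **`Ψ₋(σ) = k₋(σ) ⋆ h ≤ e^{σΔ} h`** for a continuous compactly supported weight `h ≥ 0`
(`A ≥ 0`, `σ > 0`). [folklore] -/
theorem driftKernelBarrier_neg_le_heatExtension {A : ℝ} (hA : 0 ≤ A) {h : E → ℝ}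
    (hh : Continuous h) (hhs : HasCompactSupport h) (h0 : ∀ z, 0 ≤ h z) {σ : ℝ} (hσ : 0 < σ)
    (x : E) :
    driftKernelBarrier (-1) A h σ x ≤ UnboundedOperators.heatExtension h σ x := by
  rw [UnboundedOperators.heatExtension_apply]
  have hsub : (∫ y, UnboundedOperators.heatKernel σ y • h (x - y)) =
      ∫ z, UnboundedOperators.heatKernel σ (x - z) * h z := by
    have e := integral_sub_left_eq_self
      (fun y => UnboundedOperators.heatKernel σ y * h (x - y)) volume x
    simp only [sub_sub_cancel] at e
    simp only [smul_eq_mul]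
    exact e.symm
  rw [hsub]
  have hint : Integrable fun z => UnboundedOperators.heatKernel σ (x - z) * h z := by
    refine Continuous.integrable_of_hasCompactSupport ?_ ?_
    · exact ((UnboundedOperators.continuous_heatKernel σ).comp (by fun_prop)).mul hh
    · exact HasCompactSupport.intro hhs fun z hz => by
        simp [image_eq_zero_of_notMem_tsupport hz]
  refine driftKernelBarrier_le_integral hh hhs hσ x hint fun z => ?_
  rw [mul_comm]
  exact mul_le_mul_of_nonneg_right (driftKernel_neg_one_le_heatKernel hA hσ _) (h0 z)

/-! ### Comparison with the kernel barrier on a straight cylinder -/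

section Comparison

variable {a : ℝ → E → E} {u : ℝ → E → ℝ} {A : ℝ} {S : Set ℝ} {U : Set E}

omit [InnerProductSpace ℝ E] [FiniteDimensional ℝ E] [MeasurableSpace E] [BorelSpace E] in
/-- `‖x − c‖² ≤ ρ²` means `x ∈ B̄(c, ρ)` (`ρ ≥ 0`). [folklore] -/
theorem mem_closedBall_of_norm_sq_le {x c : E} {ρ : ℝ} (hρ : 0 ≤ ρ)
    (hx : ‖x - c‖ ^ 2 ≤ ρ ^ 2) : x ∈ closedBall c ρ := by
  rw [mem_closedBall, dist_eq_norm]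
  exact (pow_le_pow_iff_left₀ (norm_nonneg _) hρ two_ne_zero).1 hx

omit [InnerProductSpace ℝ E] [FiniteDimensional ℝ E] [MeasurableSpace E] [BorelSpace E] in
/-- On the support of a weight carried by `B̄(c, r_s)`, points of `B̄(c, r_e)` are within
`r_e + r_s`. [folklore] -/
theorem norm_sub_le_of_mem_tsupport {h : E → ℝ} {c x z : E} {rs re : ℝ}
    (hhs : tsupport h ⊆ closedBall c rs) (hz : z ∈ tsupport h) (hx : x ∈ closedBall c re) :
    ‖x - z‖ ≤ re + rs := by
  have h1 : dist x c ≤ re := mem_closedBall.1 hx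
  have h2 : dist z c ≤ rs := mem_closedBall.1 (hhs hz)
  rw [← dist_eq_norm]
  linarith [dist_triangle x c z, dist_comm c z]

omit [InnerProductSpace ℝ E] [FiniteDimensional ℝ E] [MeasurableSpace E] [BorelSpace E] in
/-- On the support of a weight carried by `B̄(c, r_s)`, points of the sphere `‖x − c‖ = ρ` are
at distance `≥ ρ − r_s`. [folklore] -/
theorem le_norm_sub_of_mem_tsupport {h : E → ℝ} {c x z : E} {rs ρ : ℝ}
    (hhs : tsupport h ⊆ closedBall c rs) (hz : z ∈ tsupport h) (hx : ‖x - c‖ = ρ) :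
    ρ - rs ≤ ‖x - z‖ := by
  have h2 : dist z c ≤ rs := mem_closedBall.1 (hhs hz)
  rw [← dist_eq_norm] at hx ⊢
  linarith [dist_triangle x z c]

/-- **Comparison with the kernel barrier** (the parabolic-boundary bookkeeping). Let `u` be in the
local class on `S × U` (`U` open, `A ≥ 0`), `[t_b, t_T] ⊆ S`, `B̄(c, ρ) ⊆ U`, `u ≥ 0` on the
lateral boundary `[t_b, t_T] × {‖x − c‖ = ρ}`; let `h ≥ 0` be continuous with
`tsupport h ⊆ B̄(c, r_s)`, `0 < r_s < ρ`, and let `σ₀ > 0`, `δ ≥ 0` be such that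
`2n (t_T − t_b + σ₀) ≤ (ρ − r_s)²` and `Ψ(σ₀, ·) ≤ u(t_b, ·) + δ` on `B̄(c, ρ)`
(`Ψ = driftKernelBarrier (−1) A h`). Then on `[t_b, t_T] × B̄(c, ρ)`:
`Ψ(t − t_b + σ₀, x) − (∫ h) gaussTail n (ρ − r_s) (t − t_b + σ₀) − δ ≤ u(t, x)`.
Proof: `paraboloid_comparison` with `P ≡ ρ²`; the barrier is a classical subsolution by
`driftKernelBarrier_ineq` and `gaussTailDt_nonneg`, is `≤ u(t_b, ·)` at the bottom by hypothesis
and `≤ −δ < 0 ≤ u` on the side by `driftKernel_le_gaussTail`. [cite: Lieberman1996, Ch. II Cor. 2.5 (comparison), Ch. VI Thm 6.18 (use)] -/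
theorem IsDriftHeatSolutionOn.kernel_comparison (hu : IsDriftHeatSolutionOn a u A S U)
    (hU : IsOpen U) (hA : 0 ≤ A) {c : E} {ρ rs t_b t_T σ₀ δ : ℝ} (hrs : 0 < rs) (hrsρ : rs < ρ)
    (hS : Icc t_b t_T ⊆ S) (hBU : closedBall c ρ ⊆ U)
    (hpos : ∀ t ∈ Icc t_b t_T, ∀ x : E, ‖x - c‖ = ρ → 0 ≤ u t x)
    {h : E → ℝ} (hh : Continuous h) (h0 : ∀ z, 0 ≤ h z) (hhs : tsupport h ⊆ closedBall c rs)
    (hσ₀ : 0 < σ₀) (hδ : 0 ≤ δ)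
    (hroom : 2 * (Module.finrank ℝ E : ℝ) * (t_T - t_b + σ₀) ≤ (ρ - rs) ^ 2)
    (hbot : ∀ x ∈ closedBall c ρ, driftKernelBarrier (-1) A h σ₀ x ≤ u t_b x + δ) :
    ∀ t ∈ Icc t_b t_T, ∀ x ∈ closedBall c ρ,
      driftKernelBarrier (-1) A h (t - t_b + σ₀) x -
        (∫ z, h z) * gaussTail (Module.finrank ℝ E) (ρ - rs) (t - t_b + σ₀) - δ ≤ u t x := by
  set n : ℝ := (Module.finrank ℝ E : ℝ) with hn
  set m : ℝ := ∫ z, h z with hm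
  set d : ℝ := ρ - rs with hd_def
  have hρ : 0 < ρ := hrs.trans hrsρ
  have hd : 0 < d := by rw [hd_def]; linarith
  have hn0 : 0 ≤ n := by rw [hn]; exact Nat.cast_nonneg _
  have hm0 : 0 ≤ m := integral_nonneg h0
  have hhc : HasCompactSupport h :=
    (isCompact_closedBall c rs).of_isClosed_subset (isClosed_tsupport h) hhs
  have hage : ∀ t ∈ Icc t_b t_T, 0 < t - t_b + σ₀ := fun t ht => by linarith [ht.1]
  -- notation for the barrier data
  set Ψ : ℝ → E → ℝ := driftKernelBarrier (E := E) (-1) A h with hΨ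
  set Ψt : ℝ → E → ℝ := driftKernelBarrierDt (E := E) (-1) A h with hΨt
  have hshift : Continuous fun τ : ℝ => τ - t_b + σ₀ := by fun_prop
  have hmaps : MapsTo (fun τ : ℝ => τ - t_b + σ₀) (Icc t_b t_T) (Ioi 0) := fun τ hτ => hage τ hτ
  -- space derivatives of the barrier slices do not see the time-dependent constants
  have hDφ : ∀ τ : ℝ, ∀ x : E,
      fderiv ℝ (fun x' => Ψ (τ - t_b + σ₀) x' - m * gaussTail n d (τ - t_b + σ₀) - δ) x =
        fderiv ℝ (Ψ (τ - t_b + σ₀)) x := by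
    intro τ x
    simp only [fderiv_sub_const]
  have hΔφ : ∀ τ ∈ Icc t_b t_T, ∀ x : E,
      (Δ fun x' => Ψ (τ - t_b + σ₀) x' - m * gaussTail n d (τ - t_b + σ₀) - δ) x =
        (Δ (Ψ (τ - t_b + σ₀))) x := by
    intro τ hτ x
    have h2 : ContDiffAt ℝ 2 (Ψ (τ - t_b + σ₀)) x :=
      (contDiff_driftKernelBarrier hh hhc (hage τ hτ)).contDiffAt
    have hfun : (fun x' => Ψ (τ - t_b + σ₀) x' - m * gaussTail n d (τ - t_b + σ₀) - δ) =
        Ψ (τ - t_b + σ₀) - fun _ => m * gaussTail n d (τ - t_b + σ₀) + δ := by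
      funext x'
      simp only [Pi.sub_apply]
      ring
    rw [hfun, h2.laplacian_sub contDiffAt_const, laplacian_const]
    simp
  have key := hu.paraboloid_comparison hU hS (c := c) (P := fun _ => ρ ^ 2) continuous_const
    (fun t _ x hx => hBU (mem_closedBall_of_norm_sq_le hρ.le hx))
    (φ := fun τ x => Ψ (τ - t_b + σ₀) x - m * gaussTail n d (τ - t_b + σ₀) - δ)
    (φt := fun τ x => Ψt (τ - t_b + σ₀) x - m * gaussTailDt n d (τ - t_b + σ₀))
    ?_ ?_ ?_ ?_ ?_ ?_ ?_ ?_ ?_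
  · -- conclusion
    intro t ht x hx
    have hx2 : ‖x - c‖ ^ 2 ≤ ρ ^ 2 := by
      have h1 : ‖x - c‖ ≤ ρ := by rw [← dist_eq_norm]; exact mem_closedBall.1 hx
      exact pow_le_pow_left₀ (norm_nonneg _) h1 2
    exact key t ht x hx2
  · -- joint continuity of the barrier
    have h1 : ContinuousOn (fun q : ℝ × E => Ψ (q.1 - t_b + σ₀) q.2) (Icc t_b t_T ×ˢ univ) := by
      refine ContinuousOn.comp (g := fun p : ℝ × E => Ψ p.1 p.2)
        (f := fun q : ℝ × E => (q.1 - t_b + σ₀, q.2))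
        (continuousOn_driftKernelBarrier hh hhc) (by fun_prop) ?_
      rintro ⟨τ, x⟩ ⟨hτ, -⟩
      exact ⟨hage τ hτ, mem_univ _⟩
    have h2 : ContinuousOn (fun q : ℝ × E => m * gaussTail n d (q.1 - t_b + σ₀))
        (Icc t_b t_T ×ˢ univ) := by
      refine continuousOn_const.mul ?_
      refine ContinuousOn.comp (g := gaussTail n d) (f := fun q : ℝ × E => q.1 - t_b + σ₀)
        (continuousOn_gaussTail n d) (by fun_prop) ?_
      rintro ⟨τ, x⟩ ⟨hτ, -⟩
      exact hage τ hτ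
    exact (h1.sub h2).sub continuousOn_const
  · -- `C²` slices
    intro τ hτ
    exact ((contDiff_driftKernelBarrier hh hhc (hage τ hτ)).sub contDiff_const).sub
      contDiff_const
  · -- time derivative
    intro x τ hτ
    have h1 : HasDerivAt (fun τ' : ℝ => τ' - t_b + σ₀) 1 τ := by
      simpa using ((hasDerivAt_id τ).sub_const t_b).add_const σ₀
    have hΨ' := (hasDerivAt_driftKernelBarrier_sigma (ε := -1) (A := A) hh hhc (hage τ hτ) x).comp
      τ h1
    have hG := (hasDerivAt_gaussTail n d (hage τ hτ)).comp τ h1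
    have h3 := (hΨ'.sub (hG.const_mul m)).sub_const δ
    simp only [mul_one, Function.comp_def] at h3
    exact h3
  · -- continuity of the time derivative
    intro x
    have h1 : ContinuousOn (fun τ => Ψt (τ - t_b + σ₀) x) (Icc t_b t_T) :=
      (continuousOn_driftKernelBarrierDt hh hhc x).comp hshift.continuousOn hmaps
    have h2 : ContinuousOn (fun τ => m * gaussTailDt n d (τ - t_b + σ₀)) (Icc t_b t_T) :=
      continuousOn_const.mul ((continuousOn_gaussTailDt n d).comp hshift.continuousOn hmaps)
    exact h1.sub h2
  · -- continuity of the gradient in time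
    intro x
    have h1 : ContinuousOn (fun τ => fderiv ℝ (Ψ (τ - t_b + σ₀)) x) (Icc t_b t_T) :=
      (continuousOn_fderiv_driftKernelBarrier hh hhc x).comp hshift.continuousOn hmaps
    exact h1.congr fun τ _ => hDφ τ x
  · -- continuity of the Laplacian in time
    intro x
    have h1 : ContinuousOn (fun τ => (Δ (Ψ (τ - t_b + σ₀))) x) (Icc t_b t_T) :=
      (continuousOn_laplacian_driftKernelBarrier hh hhc x).comp hshift.continuousOn hmaps
    exact h1.congr fun τ hτ => hΔφ τ hτ x
  · -- the differential inequality `φₜ ≤ Δφ − A ‖∇φ‖`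
    intro τ hτ x _
    have hτ' : τ ∈ Icc t_b t_T := ⟨hτ.1.le, hτ.2⟩
    have hage' := hage τ hτ'
    rw [hΔφ τ hτ' x, hDφ τ x]
    have hB := driftKernelBarrier_ineq (ε := -1) hh hhc h0 (Or.inr rfl) hA hage' x
    have h2n : 2 * n * (τ - t_b + σ₀) ≤ d ^ 2 := by
      have h1 : τ - t_b + σ₀ ≤ t_T - t_b + σ₀ := by linarith [hτ.2]
      have h2 : 2 * n * (τ - t_b + σ₀) ≤ 2 * n * (t_T - t_b + σ₀) :=
        mul_le_mul_of_nonneg_left h1 (by positivity)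
      exact h2.trans hroom
    have hGt : 0 ≤ gaussTailDt n d (τ - t_b + σ₀) := gaussTailDt_nonneg hage' h2n
    have hmG : 0 ≤ m * gaussTailDt n d (τ - t_b + σ₀) := mul_nonneg hm0 hGt
    simp only [hΨ, hΨt] at hB ⊢
    linarith
  · -- bottom
    intro x hx
    have hxB : x ∈ closedBall c ρ := mem_closedBall_of_norm_sq_le hρ.le hx
    have e0 : t_b - t_b + σ₀ = σ₀ := by ring
    simp only [e0]
    have hG : 0 ≤ m * gaussTail n d σ₀ := mul_nonneg hm0 (gaussTail_pos n d hσ₀).le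
    have := hbot x hxB
    simp only [hΨ]
    linarith
  · -- side
    intro τ hτ x hx
    have hage' := hage τ hτ
    have hxρ : ‖x - c‖ = ρ := (pow_left_inj₀ (norm_nonneg _) hρ.le two_ne_zero).1 hx
    have hu0 : 0 ≤ u τ x := hpos τ hτ x hxρ
    have hΨle : Ψ (τ - t_b + σ₀) x ≤ m * gaussTail n d (τ - t_b + σ₀) := by
      have hint : Integrable fun z => h z * gaussTail n d (τ - t_b + σ₀) :=
        (hh.integrable_of_hasCompactSupport hhc).mul_const _
      have := driftKernelBarrier_le_integral (ε := -1) (A := A) hh hhc hage' x hint fun z => by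
        by_cases hz : z ∈ tsupport h
        · have hy : d ≤ ‖x - z‖ := le_norm_sub_of_mem_tsupport hhs hz hxρ
          exact mul_le_mul_of_nonneg_left
            (driftKernel_le_gaussTail (ε := -1) ⟨le_rfl, by norm_num⟩ hA hage' hd.le hy) (h0 z)
        · simp [image_eq_zero_of_notMem_tsupport hz]
      rwa [integral_mul_const] at this
    simp only [hΨ] at hΨle ⊢
    linarith

/-- **Gaussian lower bound by the earlier local mass.** Let `u` be in the local class on
`S × U` (`U` open, `A ≥ 0`), `[t_b, t_T] ⊆ S`, `B̄(c, ρ) ⊆ U`, `u ≥ 0` on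
`[t_b, t_T] × {‖x − c‖ = ρ}`, `2n(t_T − t_b) < (ρ − r_s)²`; let `h` be continuous with
`0 ≤ h ≤ u(t_b, ·)` on `B̄(c, ρ)`, `0 ≤ h` everywhere and `tsupport h ⊆ B̄(c, r_s)`, `0 < r_s < ρ`.
Then for `t_b < t ≤ t_T` and `x ∈ B̄(c, r_e)` (`r_e ≤ ρ`):
`(∫ h) · (kSubLow n A (r_e + r_s) (t − t_b) − gaussTail n (ρ − r_s) (t − t_b)) ≤ u(t, x)`.
Proof: `kernel_comparison` with the bottom slack `δ` supplied by `exists_heatExtension_le_add`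
(and `driftKernelBarrier_neg_le_heatExtension`), the in-ball bound `kSubLow_le_driftKernel` for
`Ψ(t − t_b + σ₀, x)`, and the limits `σ₀ → 0⁺`, `δ → 0⁺`. [cite: Lieberman1996, Ch. VI Thm 6.18, Cor 6.24 (Gaussian-comparison proof of the lower bound)] -/
theorem IsDriftHeatSolutionOn.kernel_lower_bound (hu : IsDriftHeatSolutionOn a u A S U)
    (hU : IsOpen U) (hA : 0 ≤ A) {c : E} {ρ rs re t_b t_T : ℝ} (hrs : 0 < rs) (hrsρ : rs < ρ)
    (hreρ : re ≤ ρ) (hS : Icc t_b t_T ⊆ S) (hBU : closedBall c ρ ⊆ U)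
    (hn : 2 * (Module.finrank ℝ E : ℝ) * (t_T - t_b) < (ρ - rs) ^ 2)
    (hpos : ∀ t ∈ Icc t_b t_T, ∀ x : E, ‖x - c‖ = ρ → 0 ≤ u t x)
    {h : E → ℝ} (hh : Continuous h) (h0 : ∀ z, 0 ≤ h z) (hhs : tsupport h ⊆ closedBall c rs)
    (hhu : ∀ x ∈ closedBall c ρ, h x ≤ u t_b x) :
    ∀ t ∈ Ioc t_b t_T, ∀ x ∈ closedBall c re,
      (∫ z, h z) * (kSubLow (Module.finrank ℝ E) A (re + rs) (t - t_b) -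
        gaussTail (Module.finrank ℝ E) (ρ - rs) (t - t_b)) ≤ u t x := by
  intro t ht x hx
  set n : ℝ := (Module.finrank ℝ E : ℝ) with hn_def
  set m : ℝ := ∫ z, h z with hm
  set d : ℝ := ρ - rs with hd_def
  set D : ℝ := re + rs with hD_def
  have hρ : 0 < ρ := hrs.trans hrsρ
  have hd : 0 < d := by rw [hd_def]; linarith
  have hn0 : 0 ≤ n := by rw [hn_def]; exact Nat.cast_nonneg _
  have hm0 : 0 ≤ m := integral_nonneg h0
  have hhc : HasCompactSupport h :=
    (isCompact_closedBall c rs).of_isClosed_subset (isClosed_tsupport h) hhs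
  have hxρ : x ∈ closedBall c ρ := closedBall_subset_closedBall hreρ hx
  have htb : 0 < t - t_b := by linarith [ht.1]
  -- room for the age offset `σ₀`
  obtain ⟨σr, hσr, hroom⟩ : ∃ σr : ℝ, 0 < σr ∧ 2 * n * (t - t_b + σr) ≤ d ^ 2 := by
    refine ⟨(d ^ 2 - 2 * n * (t_T - t_b)) / (2 * n + 1), div_pos (by linarith) (by linarith), ?_⟩
    have h1 : 2 * n * (t - t_b) ≤ 2 * n * (t_T - t_b) :=
      mul_le_mul_of_nonneg_left (by linarith [ht.2]) (by positivity)
    have h2 : 2 * n * ((d ^ 2 - 2 * n * (t_T - t_b)) / (2 * n + 1)) ≤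
        (2 * n + 1) * ((d ^ 2 - 2 * n * (t_T - t_b)) / (2 * n + 1)) :=
      mul_le_mul_of_nonneg_right (by linarith) (div_nonneg (by linarith) (by linarith))
    have h3 : (2 * n + 1) * ((d ^ 2 - 2 * n * (t_T - t_b)) / (2 * n + 1)) =
        d ^ 2 - 2 * n * (t_T - t_b) := by
      field_simp
    nlinarith
  -- in-ball lower bound of the barrier at `x`
  have hΨge : ∀ {σ : ℝ}, 0 < σ → m * kSubLow n A D σ ≤ driftKernelBarrier (-1) A h σ x := by
    intro σ hσ
    have hint : Integrable fun z => h z * kSubLow n A D σ :=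
      (hh.integrable_of_hasCompactSupport hhc).mul_const _
    have := integral_le_driftKernelBarrier (ε := -1) (A := A) hh hhc hσ x hint fun z => by
      by_cases hz : z ∈ tsupport h
      · have hy : ‖x - z‖ ≤ D := norm_sub_le_of_mem_tsupport hhs hz hx
        exact mul_le_mul_of_nonneg_left
          (kSubLow_le_driftKernel (ε := -1) (by norm_num) hA hσ hy) (h0 z)
      · simp [image_eq_zero_of_notMem_tsupport hz]
    rwa [integral_mul_const] at this
  -- for every `δ > 0`
  refine le_of_forall_pos_le_add fun δ hδ => ?_
  obtain ⟨σ₁, hσ₁, hUAI⟩ := exists_heatExtension_le_add hh hhc (isCompact_closedBall c ρ) hδ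
  have key : ∀ σ₀ ∈ Ioo 0 (min σ₁ σr),
      m * (kSubLow n A D (t - t_b + σ₀) - gaussTail n d (t - t_b + σ₀)) - δ ≤ u t x := by
    intro σ₀ hσ₀
    have hσ₀1 : σ₀ < σ₁ := hσ₀.2.trans_le (min_le_left _ _)
    have hσ₀r : σ₀ < σr := hσ₀.2.trans_le (min_le_right _ _)
    have hroom' : 2 * n * (t - t_b + σ₀) ≤ d ^ 2 := by
      have : 2 * n * (t - t_b + σ₀) ≤ 2 * n * (t - t_b + σr) :=
        mul_le_mul_of_nonneg_left (by linarith) (by positivity)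
      exact this.trans hroom
    have hbot : ∀ x' ∈ closedBall c ρ, driftKernelBarrier (-1) A h σ₀ x' ≤ u t_b x' + δ := by
      intro x' hx'
      calc driftKernelBarrier (-1) A h σ₀ x'
          ≤ UnboundedOperators.heatExtension h σ₀ x' :=
            driftKernelBarrier_neg_le_heatExtension hA hh hhc h0 hσ₀.1 x'
        _ ≤ h x' + δ := hUAI σ₀ ⟨hσ₀.1, hσ₀1⟩ x' hx'
        _ ≤ u t_b x' + δ := by linarith [hhu x' hx']
    have hcomp := hu.kernel_comparison hU hA hrs hrsρ (t_T := t)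
      (fun τ hτ => hS ⟨hτ.1, hτ.2.trans ht.2⟩) hBU
      (fun τ hτ x' hx' => hpos τ ⟨hτ.1, hτ.2.trans ht.2⟩ x' hx') hh h0 hhs hσ₀.1 hδ.le
      hroom' hbot t ⟨ht.1.le, le_rfl⟩ x hxρ
    have hlow := hΨge (σ := t - t_b + σ₀) (by linarith [hσ₀.1])
    linarith
  -- the limit `σ₀ → 0⁺`
  have hcont : ContinuousAt
      (fun σ₀ => m * (kSubLow n A D (t - t_b + σ₀) - gaussTail n d (t - t_b + σ₀)) - δ) 0 := by
    have hk : ContinuousAt (fun σ₀ => kSubLow n A D (t - t_b + σ₀)) 0 := by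
      refine ContinuousAt.comp (g := kSubLow n A D) (f := fun σ₀ : ℝ => t - t_b + σ₀) ?_
        (by fun_prop)
      exact (continuousOn_kSubLow n A D).continuousAt (Ioi_mem_nhds (by simpa using htb))
    have hg : ContinuousAt (fun σ₀ => gaussTail n d (t - t_b + σ₀)) 0 := by
      refine ContinuousAt.comp (g := gaussTail n d) (f := fun σ₀ : ℝ => t - t_b + σ₀) ?_
        (by fun_prop)
      exact (continuousOn_gaussTail n d).continuousAt (Ioi_mem_nhds (by simpa using htb))
    exact ((hk.sub hg).const_mul m).sub continuousAt_const
  have hlim := hcont.tendsto.mono_left (nhdsWithin_le_nhds (s := Ioi (0 : ℝ)))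
  have hev : ∀ᶠ σ₀ in 𝓝[>] (0 : ℝ),
      m * (kSubLow n A D (t - t_b + σ₀) - gaussTail n d (t - t_b + σ₀)) - δ ≤ u t x := by
    filter_upwards [Ioo_mem_nhdsGT (lt_min hσ₁ hσr)] with σ₀ hσ₀ using key σ₀ hσ₀
  have h0lim := le_of_tendsto hlim hev
  simp only [add_zero] at h0lim
  linarith
end Comparison

end Literature.Analysis.FluidPDE

end
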